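import Mathlib.Analysis.Matrix.Order
import Mathlib.Analysis.Matrix.PosDef
import Mathlib.Analysis.Complex.Basic
import HarnessLib

/-!
# Spectrum of dissipative Hamiltonian matrices `A = (J − R)Q`

[cite: MehlMehrmannWojtylak2018, Theorem 21 (i), (ii) (the case `E = I`; «Part (i) and (ii) of Theorem 21 generalize [MehMS16] in which these results were proved for the case E = I and Q > 0»)]
[primary: MehlMehrmannWojtylak2018]
[normalized: real square matrices; `L = J − R` is encoded by the single hypothesis `yᵀLy ≤ 0` for all real `y` (i.e. the symmetric part `R = −½(L + Lᵀ) ⪰ 0`, `J = ½(L − Lᵀ)` arbitrary skew), `Q` real symmetric positive semidefinite (`Matrix.PosSemidef`); eigenpairs are complex eigenpairs of the complexified matrix `(LQ).map (algebraMap ℝ ℂ)`, the convention of `Analysis/ODE/LyapunovIndirectMethod`; the descriptor (`E ≠ I`), rectangular and Kronecker-index statements (iii)–(v) of the theorem are NOT typed]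

A matrix `A = (J − R)Q` with `J = −Jᵀ`, `R = Rᵀ ⪰ 0`, `Q = Qᵀ ⪰ 0` — the system matrix of a linear
port-Hamiltonian («dissipative Hamiltonian») system `ẋ = (J − R)Qx` with Hamiltonian `½xᵀQx` — has
all its eigenvalues in the closed left half-plane, and an eigenvector `v` of an eigenvalue on the
imaginary axis carries no dissipation: `RQv = 0`.  The one-line proof: for `LQv = μv` put `w = Qv`;
then `Re μ · v*Qv = Re (w*Lw) = −w*Rw ≤ 0`, and `v*Qv = 0` forces `Qv = 0`, `μv = 0`.

These two facts are the common core of the linearised-stability arguments for several power-system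
models in this library (swing equations `M⁻¹`-weighted, droop-controlled microgrids
`PowerSystems.DroopPH.eig_re_neg_or_rotation`), each of which previously re-derived them for its
own block structure; this file states them once, abstractly, in real form.

## What is proved (sorry-free)
* `dh_re_mul_form_eq` — the real-form identity behind the argument: if `(LQ)a = αa − βb`,
  `(LQ)b = αb + βa` (real and imaginary parts of a complex eigenpair) and `Q` is symmetric, then
  `α(aᵀQa + bᵀQb) = (Qa)ᵀL(Qa) + (Qb)ᵀL(Qb)`.
* **`eig_re_nonpos_of_dissipativeHamiltonian`** — Theorem 21 (i), `E = I`: every eigenvalue `μ`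
  of `LQ` has `Re μ ≤ 0`.
* **`symmPart_mulVec_eq_zero_of_eig_re_eq_zero`** — Theorem 21 (ii), eigenvector clause, `E = I`:
  if `Re μ = 0` then `(L + Lᵀ)Qv = 0` (i.e. `RQv = 0`), for the real and imaginary parts of `v`.
* **`eig_re_neg_of_strictlyDissipative`** — the strict case used for asymptotic stability: if
  `yᵀLy < 0` for `y ≠ 0` (`R ≻ 0`) and `Q ≻ 0`, every eigenvalue of `LQ` has `Re μ < 0`.
-/

open scoped Matrix
open Matrix

namespace Literature.LinearAlgebra.Matrix

variable {ι : Type*} [Fintype ι]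

section DissipativeHamiltonian

/-- Real and imaginary parts of a complex eigen-equation of a real matrix. [folklore] -/
private theorem dh_mulVec_re_im_of_map_eigen (A : Matrix ι ι ℝ) {μ : ℂ} {v : ι → ℂ}
    (h : A.map (algebraMap ℝ ℂ) *ᵥ v = μ • v) :
    (A *ᵥ fun i => (v i).re) = (fun i => μ.re * (v i).re - μ.im * (v i).im) ∧
      (A *ᵥ fun i => (v i).im) = (fun i => μ.re * (v i).im + μ.im * (v i).re) := by
  constructor
  · funext i
    have := congrArg Complex.re (congrFun h i)
    simpa [Matrix.mulVec, dotProduct, Complex.mul_re, Complex.re_sum] using this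
  · funext i
    have := congrArg Complex.im (congrFun h i)
    simpa [Matrix.mulVec, dotProduct, Complex.mul_im, Complex.im_sum] using this

/-- **The real-form identity.**  If `(LQ)a = αa − βb` and `(LQ)b = αb + βa` with `Q` symmetric, then
`α(aᵀQa + bᵀQb) = (Qa)ᵀL(Qa) + (Qb)ᵀL(Qb)` (the `β`-terms cancel by symmetry of `Q`).
[cite: MehlMehrmannWojtylak2018, proof of Theorem 21 (i) (case E = I)] -/
theorem dh_re_mul_form_eq {L Q : Matrix ι ι ℝ} (hQ : Qᵀ = Q) {α β : ℝ} {a b : ι → ℝ}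
    (ha : (L * Q) *ᵥ a = α • a - β • b) (hb : (L * Q) *ᵥ b = α • b + β • a) :
    α * (a ⬝ᵥ (Q *ᵥ a) + b ⬝ᵥ (Q *ᵥ b))
      = (Q *ᵥ a) ⬝ᵥ (L *ᵥ (Q *ᵥ a)) + (Q *ᵥ b) ⬝ᵥ (L *ᵥ (Q *ᵥ b)) := by
  have h1 : (Q *ᵥ a) ⬝ᵥ (L *ᵥ (Q *ᵥ a)) = α * ((Q *ᵥ a) ⬝ᵥ a) - β * ((Q *ᵥ a) ⬝ᵥ b) := by
    rw [mulVec_mulVec, ha, dotProduct_sub, dotProduct_smul, dotProduct_smul, smul_eq_mul, smul_eq_mul]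
  have h2 : (Q *ᵥ b) ⬝ᵥ (L *ᵥ (Q *ᵥ b)) = α * ((Q *ᵥ b) ⬝ᵥ b) + β * ((Q *ᵥ b) ⬝ᵥ a) := by
    rw [mulVec_mulVec, hb, dotProduct_add, dotProduct_smul, dotProduct_smul, smul_eq_mul, smul_eq_mul]
  -- symmetry of `Q`: `(Qb)·a = (Qa)·b`, and `(Qa)·a = a·(Qa)`
  have hsym : (Q *ᵥ b) ⬝ᵥ a = (Q *ᵥ a) ⬝ᵥ b := by
    rw [dotProduct_comm (Q *ᵥ b) a, dotProduct_mulVec, ← mulVec_transpose, hQ]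
  have hsa : (Q *ᵥ a) ⬝ᵥ a = a ⬝ᵥ (Q *ᵥ a) := dotProduct_comm _ _
  have hsb : (Q *ᵥ b) ⬝ᵥ b = b ⬝ᵥ (Q *ᵥ b) := dotProduct_comm _ _
  rw [h1, h2, hsym, hsa, hsb]
  ring

/-- **Theorem 21 (i) of Mehl–Mehrmann–Wojtylak (case `E = I`): dissipative Hamiltonian matrices
have their spectrum in the closed left half-plane.**  `L` real with `yᵀLy ≤ 0` for all `y`
(`L = J − R`, `R ⪰ 0`), `Q` real symmetric positive semidefinite: every complex eigenvalue `μ` of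
`LQ` satisfies `Re μ ≤ 0`.
[cite: MehlMehrmannWojtylak2018, Theorem 21 (i) (E = I)] -/
theorem eig_re_nonpos_of_dissipativeHamiltonian {L Q : Matrix ι ι ℝ}
    (hL : ∀ y : ι → ℝ, y ⬝ᵥ (L *ᵥ y) ≤ 0) (hQ : Q.PosSemidef) {μ : ℂ} {v : ι → ℂ} (hv : v ≠ 0)
    (hev : (L * Q).map (algebraMap ℝ ℂ) *ᵥ v = μ • v) : μ.re ≤ 0 := by
  obtain ⟨hre, him⟩ := dh_mulVec_re_im_of_map_eigen _ hev
  obtain ⟨a, hadef⟩ : ∃ a : ι → ℝ, a = fun i => (v i).re := ⟨_, rfl⟩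
  obtain ⟨b, hbdef⟩ : ∃ b : ι → ℝ, b = fun i => (v i).im := ⟨_, rfl⟩
  have ha : (L * Q) *ᵥ a = μ.re • a - μ.im • b := by
    rw [hadef, hbdef, hre]; funext i; simp
  have hb : (L * Q) *ᵥ b = μ.re • b + μ.im • a := by
    rw [hadef, hbdef, him]; funext i; simp
  have hQs : Qᵀ = Q := by
    have := hQ.isHermitian
    rwa [IsHermitian, conjTranspose_eq_transpose_of_trivial] at this
  have key := dh_re_mul_form_eq hQs ha hb
  have hrhs : (Q *ᵥ a) ⬝ᵥ (L *ᵥ (Q *ᵥ a)) + (Q *ᵥ b) ⬝ᵥ (L *ᵥ (Q *ᵥ b)) ≤ 0 :=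
    add_nonpos (hL _) (hL _)
  have hqa : 0 ≤ a ⬝ᵥ (Q *ᵥ a) := by simpa using hQ.dotProduct_mulVec_nonneg a
  have hqb : 0 ≤ b ⬝ᵥ (Q *ᵥ b) := by simpa using hQ.dotProduct_mulVec_nonneg b
  rcases (add_nonneg hqa hqb).lt_or_eq with hpos | hzero
  · -- `Re μ · (positive) ≤ 0`
    by_contra hcon
    rw [not_le] at hcon
    have := mul_pos hcon hpos
    linarith
  · -- `aᵀQa = bᵀQb = 0` ⇒ `Qa = Qb = 0` ⇒ `μ (a + ib) = 0` ⇒ `μ = 0`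
    have hqa0 : a ⬝ᵥ (Q *ᵥ a) = 0 := by linarith
    have hqb0 : b ⬝ᵥ (Q *ᵥ b) = 0 := by linarith
    have hQa : Q *ᵥ a = 0 := (hQ.dotProduct_mulVec_zero_iff a).1 (by simpa using hqa0)
    have hQb : Q *ᵥ b = 0 := (hQ.dotProduct_mulVec_zero_iff b).1 (by simpa using hqb0)
    have h1 : μ.re • a - μ.im • b = 0 := by rw [← ha, ← mulVec_mulVec, hQa, mulVec_zero]
    have h2 : μ.re • b + μ.im • a = 0 := by rw [← hb, ← mulVec_mulVec, hQb, mulVec_zero]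
    -- `Re μ (a·a + b·b) = a·(αa − βb) + b·(αb + βa) = 0`
    have h3 : μ.re * (a ⬝ᵥ a + b ⬝ᵥ b) = a ⬝ᵥ (μ.re • a - μ.im • b) + b ⬝ᵥ (μ.re • b + μ.im • a) := by
      simp only [dotProduct_sub, dotProduct_add, dotProduct_smul, smul_eq_mul, dotProduct_comm b a]
      ring
    rw [h1, h2, dotProduct_zero, dotProduct_zero, add_zero] at h3
    have hab : 0 < a ⬝ᵥ a + b ⬝ᵥ b := by
      obtain ⟨i, hi⟩ := Function.ne_iff.1 hv
      have hi' : (v i).re ≠ 0 ∨ (v i).im ≠ 0 := by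
        by_contra hcon
        simp only [not_or, not_not] at hcon
        exact hi (Complex.ext (by simpa using hcon.1) (by simpa using hcon.2))
      have haa : 0 ≤ a ⬝ᵥ a := by
        simp only [dotProduct]; exact Finset.sum_nonneg fun j _ => mul_self_nonneg _
      have hbb : 0 ≤ b ⬝ᵥ b := by
        simp only [dotProduct]; exact Finset.sum_nonneg fun j _ => mul_self_nonneg _
      rcases hi' with h | h
      · have : 0 < a ⬝ᵥ a := by
          simp only [dotProduct, hadef]
          exact lt_of_lt_of_le (mul_self_pos.2 h)
            (Finset.single_le_sum (fun j _ => mul_self_nonneg ((v j).re)) (Finset.mem_univ i))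
        linarith
      · have : 0 < b ⬝ᵥ b := by
          simp only [dotProduct, hbdef]
          exact lt_of_lt_of_le (mul_self_pos.2 h)
            (Finset.single_le_sum (fun j _ => mul_self_nonneg ((v j).im)) (Finset.mem_univ i))
        linarith
    have : μ.re = 0 := by
      rcases mul_eq_zero.1 h3 with h | h
      · exact h
      · exact absurd h hab.ne'
    exact this.le

/-- **Theorem 21 (ii) of Mehl–Mehrmann–Wojtylak, eigenvector clause (case `E = I`): a mode on the
imaginary axis is undamped.**  Under the same hypotheses, if `Re μ = 0` then `(L + Lᵀ)(Qv) = 0`,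
i.e. `RQv = 0` with `R = −½(L + Lᵀ)` — stated for the real and the imaginary part of `v`.
[cite: MehlMehrmannWojtylak2018, Theorem 21 (ii) («if the columns of V form a basis of a regular deflating subspace … associated with λ₀, then RQV = 0»; E = I)] -/
theorem symmPart_mulVec_eq_zero_of_eig_re_eq_zero {L Q : Matrix ι ι ℝ}
    (hL : ∀ y : ι → ℝ, y ⬝ᵥ (L *ᵥ y) ≤ 0) (hQ : Q.PosSemidef) {μ : ℂ} {v : ι → ℂ}
    (hev : (L * Q).map (algebraMap ℝ ℂ) *ᵥ v = μ • v) (hre : μ.re = 0) :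
    (L + Lᵀ) *ᵥ (Q *ᵥ fun i => (v i).re) = 0 ∧ (L + Lᵀ) *ᵥ (Q *ᵥ fun i => (v i).im) = 0 := by
  obtain ⟨hre', him⟩ := dh_mulVec_re_im_of_map_eigen _ hev
  obtain ⟨a, hadef⟩ : ∃ a : ι → ℝ, a = fun i => (v i).re := ⟨_, rfl⟩
  obtain ⟨b, hbdef⟩ : ∃ b : ι → ℝ, b = fun i => (v i).im := ⟨_, rfl⟩
  have ha : (L * Q) *ᵥ a = μ.re • a - μ.im • b := by
    rw [hadef, hbdef, hre']; funext i; simp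
  have hb : (L * Q) *ᵥ b = μ.re • b + μ.im • a := by
    rw [hadef, hbdef, him]; funext i; simp
  have hQs : Qᵀ = Q := by
    have := hQ.isHermitian
    rwa [IsHermitian, conjTranspose_eq_transpose_of_trivial] at this
  have key := dh_re_mul_form_eq hQs ha hb
  rw [hre, zero_mul] at key
  have h1 := hL (Q *ᵥ a)
  have h2 := hL (Q *ᵥ b)
  have hz1 : (Q *ᵥ a) ⬝ᵥ (L *ᵥ (Q *ᵥ a)) = 0 := by linarith
  have hz2 : (Q *ᵥ b) ⬝ᵥ (L *ᵥ (Q *ᵥ b)) = 0 := by linarith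
  -- `−(L + Lᵀ)` is positive semidefinite, with form `−2yᵀLy`
  have hform : ∀ y : ι → ℝ, y ⬝ᵥ ((-(L + Lᵀ)) *ᵥ y) = -(2 * (y ⬝ᵥ (L *ᵥ y))) := by
    intro y
    rw [neg_mulVec, dotProduct_neg, add_mulVec, dotProduct_add, mulVec_transpose,
      dotProduct_comm y (y ᵥ* L), ← dotProduct_mulVec]
    ring
  have hS : (-(L + Lᵀ)).PosSemidef := by
    refine PosSemidef.of_dotProduct_mulVec_nonneg ?_ fun y => ?_
    · rw [IsHermitian, conjTranspose_eq_transpose_of_trivial, transpose_neg, transpose_add,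
        transpose_transpose, add_comm]
    · rw [star_trivial, hform]
      linarith [hL y]
  have hker : ∀ y : ι → ℝ, y ⬝ᵥ (L *ᵥ y) = 0 → (L + Lᵀ) *ᵥ y = 0 := by
    intro y hy
    have h0 : star y ⬝ᵥ ((-(L + Lᵀ)) *ᵥ y) = 0 := by rw [star_trivial, hform, hy]; ring
    have := (hS.dotProduct_mulVec_zero_iff y).1 h0
    rwa [neg_mulVec, neg_eq_zero] at this
  rw [hadef] at hz1
  rw [hbdef] at hz2
  exact ⟨hker _ hz1, hker _ hz2⟩

/-- **Strict dissipativity gives a Hurwitz matrix**: if `yᵀLy < 0` for `y ≠ 0` (`R ≻ 0`) and `Q ≻ 0`,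
every eigenvalue of `LQ` has `Re μ < 0` (the linear pH system `ẋ = (J − R)Qx` is asymptotically
stable).  From (i) and (ii): `Re μ = 0` would force `Q Re v = Q Im v = 0`, `v = 0`.
[cite: MehlMehrmannWojtylak2018, Theorem 21 (i)–(ii) and Remark 22 (case E = I, Q > 0 of [MehMS16])] -/
theorem eig_re_neg_of_strictlyDissipative [DecidableEq ι] {L Q : Matrix ι ι ℝ}
    (hL : ∀ y : ι → ℝ, y ≠ 0 → y ⬝ᵥ (L *ᵥ y) < 0) (hQ : Q.PosDef) {μ : ℂ} {v : ι → ℂ}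
    (hv : v ≠ 0) (hev : (L * Q).map (algebraMap ℝ ℂ) *ᵥ v = μ • v) : μ.re < 0 := by
  have hL' : ∀ y : ι → ℝ, y ⬝ᵥ (L *ᵥ y) ≤ 0 := by
    intro y
    by_cases hy : y = 0
    · simp [hy]
    · exact (hL y hy).le
  have hle := eig_re_nonpos_of_dissipativeHamiltonian hL' hQ.posSemidef hv hev
  rcases hle.lt_or_eq with hlt | heq
  · exact hlt
  · exfalso
    obtain ⟨hre', him⟩ := dh_mulVec_re_im_of_map_eigen _ hev
    obtain ⟨a, hadef⟩ : ∃ a : ι → ℝ, a = fun i => (v i).re := ⟨_, rfl⟩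
    obtain ⟨b, hbdef⟩ : ∃ b : ι → ℝ, b = fun i => (v i).im := ⟨_, rfl⟩
    have ha : (L * Q) *ᵥ a = μ.re • a - μ.im • b := by
      rw [hadef, hbdef, hre']; funext i; simp
    have hb : (L * Q) *ᵥ b = μ.re • b + μ.im • a := by
      rw [hadef, hbdef, him]; funext i; simp
    have hQs : Qᵀ = Q := by
      have := hQ.isHermitian
      rwa [IsHermitian, conjTranspose_eq_transpose_of_trivial] at this
    have key := dh_re_mul_form_eq hQs ha hb
    rw [heq, zero_mul] at key
    have h1 := hL' (Q *ᵥ a)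
    have h2 := hL' (Q *ᵥ b)
    have hz1 : (Q *ᵥ a) ⬝ᵥ (L *ᵥ (Q *ᵥ a)) = 0 := by linarith
    have hz2 : (Q *ᵥ b) ⬝ᵥ (L *ᵥ (Q *ᵥ b)) = 0 := by linarith
    -- strictness: `Qa = 0`, `Qb = 0`, then `a = b = 0` since `Q ≻ 0`
    have hQa : Q *ᵥ a = 0 := by
      by_contra h; exact (hL _ h).ne hz1
    have hQb : Q *ᵥ b = 0 := by
      by_contra h; exact (hL _ h).ne hz2
    have hdet : Q.det ≠ 0 := hQ.det_pos.ne'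
    have ha0 : a = 0 := by
      have := congrArg (fun w => Q⁻¹ *ᵥ w) hQa
      simpa [mulVec_mulVec, nonsing_inv_mul _ (isUnit_iff_ne_zero.2 hdet)] using this
    have hb0 : b = 0 := by
      have := congrArg (fun w => Q⁻¹ *ᵥ w) hQb
      simpa [mulVec_mulVec, nonsing_inv_mul _ (isUnit_iff_ne_zero.2 hdet)] using this
    apply hv
    funext i
    have h1 : (v i).re = 0 := by rw [hadef] at ha0; exact congrFun ha0 i
    have h2 : (v i).im = 0 := by rw [hbdef] at hb0; exact congrFun hb0 i
    exact Complex.ext (by simpa using h1) (by simpa using h2)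

end DissipativeHamiltonian

end Literature.LinearAlgebra.Matrix
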